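import Summits.CriticalPhenomena.PercolationContinuityZ3.Theses.PercNearOneGluing
import Literature.Probability.Percolation.PercolationEvents
import HarnessLib.Audit
import Summits.CriticalPhenomena.PercolationContinuityZ3.Theorems.PercNearOneGluingNearOneGluingVariants2411

/-! TTRL-lite variant V2512 of stmt-CriticalPhenomena-4574

(`stub_shorteningStep` of line `kn_shortening_induction`, move `small_case+small_case`:
`n ≤ 4` and `A.card = 2`).  This variant is a weakening of the already-landed sibling variant
V2411 (`A.card = 2` alone, two relays on any number of vertices,
`stub_shorteningStep_var2411`): the extra hypothesis `n ≤ 4` is simply discarded.  (An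
independent elementary proof of the four-vertex case — case analysis `b = a₀` /
`x ∈ A` / `b = a₁` with explicit independent-edge bounds — was also checked; the corollary is
landed to avoid duplication.)  No new definitions, no named facts. -/

namespace Summit.CriticalPhenomena.PercolationContinuityZ3.Theorems

open MeasureTheory Set Literature.Probability.LatticeModels Literature.Probability.Percolation
open scoped Classical BigOperators

/-- TTRL-lite variant V2512 of `stub_shorteningStep` (stmt-CriticalPhenomena-4574, Kozma–Nitzan
Conjecture 6 with induction hypothesis): the shortening step
`ν(⋃ a ∈ A, v ↔ a) · ν(a₀ ↔ b) ≤ ν(v ↔ b)`, `ν = prodBernoulli (w[s(v,x) ↦ 1])`, for two relays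
(`A.card = 2`) on at most four vertices (`n ≤ 4`); immediate from the two-relay case
`stub_shorteningStep_var2411` (any `n`). -/
theorem stub_shorteningStep_var2512 : ∀ (n : ℕ) (w : Sym2 (Fin n) → unitInterval) (A : Finset (Fin n)) (b v x a₀ : Fin n), n ≤ 4 → A.card = 2 → v ∉ A → v ≠ x → w s(v, x) = 0 → a₀ ∈ A → (∀ a ∈ A, (prodBernoulli w).real (openConn a₀ b) ≤ (prodBernoulli w).real (openConn a b)) → (∀ w' : Sym2 (Fin n) → unitInterval, (∀ e, w e = 0 → w' e = 0) → ∀ (A' : Finset (Fin n)) (o' b' : Fin n) (t : ℝ), (∀ a ∈ A', t ≤ (prodBernoulli w').real (openConn a b')) → (prodBernoulli w').real (⋃ a ∈ A', openConn o' a) * t ≤ (prodBernoulli w').real (openConn o' b')) → (prodBernoulli (Function.update w s(v, x) 1)).real (⋃ a ∈ A, openConn v a) * (prodBernoulli (Function.update w s(v, x) 1)).real (openConn a₀ b) ≤ (prodBernoulli (Function.update w s(v, x) 1)).real (openConn v b) :=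
  fun n w A b v x a₀ _hn hA2 => stub_shorteningStep_var2411 n w A b v x a₀ hA2

end Summit.CriticalPhenomena.PercolationContinuityZ3.Theorems
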